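import Summits.BirchSwinnertonDyer.BirchSwinnertonDyer.Theorems.SignedLowerHalvesKobayashiLowerHalfSemistablePW21FixedIdeals
import Literature.NumberTheory.Automorphic.DefiniteOrderUnitsTorsion
import Literature.NumberTheory.Automorphic.BrandtEigenvectorNonEisenstein
import Literature.NumberTheory.EllipticCurves.NonEisensteinPrimeOfSurjective
import HarnessLib

/-!
# The mod-`p` Eisenstein criterion in the Brandt module at EVERY ODD prime (`p = 3` included):
# non-congruent weighted coordinates, a degree-zero pairing unit, `p ∤ i_r` — for `E[p]` IRREDUCIBLE

Route-independent `Theorems` file (cell `b2b-bsdres`, seat `b2b-bsdres-x10b` = class owner X6/X7, gen 42); part 4 of the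
series `…PW21CubeRoots` / `…PW21FixedIdeals` / `…DefmuPollackWestonLemma21` (gen 41).
HONEST FRAMING: prove what is provable now; shrink each hard class to its core with data; no claim beyond stated
classes. Nothing about any curve is asserted beyond the displayed hypotheses and NO summit statement is proved here;
BSD is not proved by any of this.

The tree's Brandt-module Eisenstein criterion (`Literature/NumberTheory/Automorphic/BrandtEigenvectorNonEisenstein.lean`:
`XiSetup.dvd_sub_prime_add_one_of_forall_dvd`, `XiSetup.exists_not_dvd_weight_mul_sub`,
`XiSetup.exists_sum_eq_zero_not_dvd_pairing`) and its elliptic-curve readings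
(`Literature/NumberTheory/EllipticCurves/PollackWestonNonEisenstein.lean`: `exists_not_dvd_weight_mul_sub`,
`exists_sum_eq_zero_not_dvd_pairing`, `not_dvd_generator_range_pairing` = "`p ∤ i_r`", Pollack–Weston Prop. 6.4 (1) /
Takahashi Lemma 2.2 + Thm. 2.7) carry the hypotheses **`5 ≤ p`** (because `p ∤ w_c` is used, `w_c ∣ 12`) and
**`ρ̄_{E,p}` surjective**. This file removes both at odd `p`:

* `dvd_sub_prime_add_one_of_forall_dvd_weight_mul` — **at `p = 3`**: if `v ∈ L(λ)` has `3 ∤ v_{c₀}` but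
  `3 ∣ w_c v_c` for EVERY class `c`, then `λ(ℓ) ≡ ℓ + 1 (mod 3)` at every prime `ℓ ∤ N⁺N⁻`. This is gen 41's argument
  (proof of `pollackWeston2011_lemma21_holds`) stated for an arbitrary eigenvector: the classes `c` with `3 ∣ w_c` have
  Brandt columns `≡ (ℓ + 1) e_c (mod 3)` (`three_dvd_matrix_of_dvd_weight`: an order-`3` unit of `O_L(I_c)` acts on the
  Brandt set without fixed points; column sum `ℓ + 1`), the others have `3 ∣ v_c`; read coordinate `c₀` of `T(ℓ) v = λ v`.
* `dvd_sub_prime_add_one_of_forall_dvd_three` / `…_odd` — the criterion of the Literature file with `5 ≤ p` replaced by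
  `p = 3` / `p ≠ 2`: `w_c v_c ≡ w_{c'} v_{c'} (mod p)` for all `c, c'` and `p ∤ v_{c₀}` force `λ(ℓ) ≡ ℓ + 1 (mod p)`
  (case `p ∤ w_{c₀} v_{c₀}`: the abstract criterion `dvd_sub_of_forall_dvd_weight_mul_sub`; case `p ∣ w_{c₀} v_{c₀}`: then
  `p ∣ w_c v_c` for all `c`, `p ∣ w_{c₀}`, so `p = 3` and the previous lemma).
* `exists_not_dvd_weight_mul_sub_odd`, `exists_sum_eq_zero_not_dvd_pairing_odd` — contrapositives (one non-Eisenstein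
  eigenvalue gives `c, c'` with `p ∤ w_c v_c - w_{c'} v_{c'}`, resp. a degree-zero `y` with `p ∤ ⟨v, y⟩`).
* `exists_not_dvd_weight_mul_sub_of_irreducible`, `exists_sum_eq_zero_not_dvd_pairing_of_irreducible`,
  `not_dvd_generator_range_pairing_of_irreducible` — the elliptic-curve readings for `λ = a(E)`, `p` ODD, `ρ̄_{E,p}`
  IRREDUCIBLE (the non-Eisenstein good prime comes from `exists_prime_not_dvd_lFunction_sub_of_hasIrreducibleModPGaloisRep`,
  Darmon–Diamond–Taylor Prop. 2.6(b)): in particular **`p ∤ i_r` for every odd `p` at which `E[p]` is irreducible** —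
  the definite-side content of Takahashi 2001 Thm. 2.7 / Pollack–Weston Prop. 6.4 (1) without `p ≥ 5` and without
  surjectivity.
* `exists_not_dvd_weight_mul_of_irreducible` — Pollack–Weston Lemma 2.1 (`∃ c, p ∤ w_c φ_c`) as a COROLLARY for every odd
  `p` and `ρ̄_{E,p}` irreducible (the landed `pollackWeston2011_lemma21_holds` asks surjective).

## References

* [PollackWeston2011] R. Pollack, T. Weston, Compos. Math. 147 (2011), §2.1 Lemma 2.1, §6.2 Prop. 6.3–6.4, §6.3.
* [Takahashi2001] S. Takahashi, J. Number Theory 90 (2001), Lemma 2.2, Thm. 2.3, Thm. 2.7.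
* [Ribet1990] K. Ribet, Invent. Math. 100 (1990), §3, Thm. 3.12.
* [Gross1987] B. H. Gross, *Heights and the special values of L-series* (1987), §§1–3.
* [DarmonDiamondTaylor1995] H. Darmon, F. Diamond, R. Taylor, *Fermat's Last Theorem* (1995), Prop. 2.6(b).
-/

noncomputable section

open scoped BigOperators Matrix

-- D-0017: single-problem summit, the namespace repeats the problem name by design.
set_option linter.dupNamespace false

namespace Summit.BirchSwinnertonDyer.BirchSwinnertonDyer.Theorems.PollackWestonLemma21

open Literature.NumberTheory.EllipticCurves Literature.NumberTheory.Automorphic Brandt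

variable {Nplus Nminus : ℕ}

/-! ### The criterion at `p = 3` -/

/-- **At `p = 3`: a primitive eigenvector all of whose weighted coordinates are divisible by `3` is Eisenstein.** Let `S`
be a Brandt setup of type `(N⁺, N⁻)`, `v ∈ L(λ)` a common eigenvector of the Brandt matrices with `3 ∤ v_{c₀}`, and
suppose `3 ∣ w_c v_c` for every class `c`. Then `λ(ℓ) ≡ ℓ + 1 (mod 3)` for every prime `ℓ ∤ N⁺N⁻`. Proof: `3 ∣ w_{c₀}`;
in row `c₀` of `T(ℓ) v = λ(ℓ) v` every off-diagonal term `T_{c₀ c} v_c` is divisible by `3` (either `3 ∣ v_c`, or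
`3 ∣ w_c` and then `3 ∣ T(ℓ)_{c₀ c}` by `three_dvd_matrix_of_dvd_weight`), and `T_{c₀ c₀} ≡ ℓ + 1 (mod 3)` because column
`c₀` sums to `ℓ + 1` (`XiSetup.sum_matrix_prime_eq`) and its off-diagonal entries are divisible by `3`. [folklore] -/
theorem dvd_sub_prime_add_one_of_forall_dvd_weight_mul (S : XiSetup Nplus Nminus) [Fintype (ClassSet S.O)]
    {lam : ℕ → ℤ} {v : ClassSet S.O → ℤ} (hv : v ∈ eigenLattice (Nplus * Nminus) (matrix S.O) lam)
    {c₀ : ClassSet S.O} (hv0 : ¬ (3 : ℤ) ∣ v c₀) (hall : ∀ c, (3 : ℤ) ∣ (weight S.O c : ℤ) * v c)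
    {ℓ : ℕ} (hℓ : ℓ.Prime) (hℓN : ¬ ℓ ∣ Nplus * Nminus) :
    (3 : ℤ) ∣ lam ℓ - (ℓ + 1) := by
  classical
  have h3Z : Prime (3 : ℤ) := by
    have := Nat.prime_iff_prime_int.mp Nat.prime_three
    simpa using this
  -- `3 ∣ w_{c₀}`
  have hpw : 3 ∣ weight S.O c₀ := by
    have := (h3Z.dvd_or_dvd (hall c₀)).resolve_right hv0
    exact_mod_cast this
  -- the eigen-equation at `ℓ`, coordinate `c₀`
  have heig := (mem_eigenLattice_iff.mp hv) ℓ hℓ hℓN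
  have hc : ∑ j, matrix S.O ℓ c₀ j * v j = lam ℓ * v c₀ := by
    have := congr_fun heig c₀
    simpa [Matrix.mulVec, dotProduct] using this
  -- off-diagonal terms of row `c₀` are divisible by `3`
  have hterm : ∀ j ∈ Finset.univ.erase c₀, (3 : ℤ) ∣ matrix S.O ℓ c₀ j * v j := by
    intro j hj
    have hjc : j ≠ c₀ := Finset.ne_of_mem_erase hj
    by_cases h3 : 3 ∣ weight S.O j
    · exact (three_dvd_matrix_of_dvd_weight S hℓ hℓN hjc.symm h3).mul_right _
    · have h3' : ¬ (3 : ℤ) ∣ (weight S.O j : ℤ) := fun h => h3 (by exact_mod_cast h)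
      exact ((h3Z.dvd_or_dvd (hall j)).resolve_left h3').mul_left _
  -- the diagonal entry is `≡ ℓ + 1 (mod 3)`
  have hdiag : (3 : ℤ) ∣ matrix S.O ℓ c₀ c₀ - (ℓ + 1) := by
    have hsum := S.sum_matrix_prime_eq hℓ hℓN c₀
    rw [← Finset.add_sum_erase _ _ (Finset.mem_univ c₀)] at hsum
    have : matrix S.O ℓ c₀ c₀ - (ℓ + 1) = -∑ i ∈ Finset.univ.erase c₀, matrix S.O ℓ i c₀ := by
      linarith
    rw [this]
    exact (Finset.dvd_sum fun i hi =>
      three_dvd_matrix_of_dvd_weight S hℓ hℓN (Finset.ne_of_mem_erase hi) hpw).neg_right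
  have hkey : (3 : ℤ) ∣ (lam ℓ - (ℓ + 1)) * v c₀ := by
    have : (lam ℓ - (ℓ + 1)) * v c₀ =
        (∑ j ∈ Finset.univ.erase c₀, matrix S.O ℓ c₀ j * v j) + (matrix S.O ℓ c₀ c₀ - (ℓ + 1)) * v c₀ := by
      rw [sub_mul, ← hc, ← Finset.add_sum_erase _ _ (Finset.mem_univ c₀)]
      ring
    rw [this]
    exact dvd_add (Finset.dvd_sum hterm) (hdiag.mul_right _)
  exact (h3Z.dvd_or_dvd hkey).resolve_right hv0

/-- **Congruent weighted coordinates force Eisenstein eigenvalues, at `p = 3`.** With `S`, `v ∈ L(λ)`, `3 ∤ v_{c₀}` as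
above: if `w_c v_c ≡ w_{c'} v_{c'} (mod 3)` for all classes `c, c'`, then `λ(ℓ) ≡ ℓ + 1 (mod 3)` for every prime
`ℓ ∤ N⁺N⁻`. If `3 ∤ w_{c₀} v_{c₀}` this is the abstract criterion `dvd_sub_of_forall_dvd_weight_mul_sub` (weight symmetry,
column sums); otherwise every `w_c v_c` is divisible by `3` and `dvd_sub_prime_add_one_of_forall_dvd_weight_mul` applies.
The Literature twin `XiSetup.dvd_sub_prime_add_one_of_forall_dvd` needs `5 ≤ p`. [folklore] -/
theorem dvd_sub_prime_add_one_of_forall_dvd_three (S : XiSetup Nplus Nminus) [Fintype (ClassSet S.O)]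
    {lam : ℕ → ℤ} {v : ClassSet S.O → ℤ} (hv : v ∈ eigenLattice (Nplus * Nminus) (matrix S.O) lam)
    {c₀ : ClassSet S.O} (hv0 : ¬ (3 : ℤ) ∣ v c₀)
    (hcong : ∀ c c', (3 : ℤ) ∣ (weight S.O c : ℤ) * v c - (weight S.O c' : ℤ) * v c')
    {ℓ : ℕ} (hℓ : ℓ.Prime) (hℓN : ¬ ℓ ∣ Nplus * Nminus) :
    (3 : ℤ) ∣ lam ℓ - (ℓ + 1) := by
  have h3Z : Prime (3 : ℤ) := by
    have := Nat.prime_iff_prime_int.mp Nat.prime_three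
    simpa using this
  by_cases hw0 : (3 : ℤ) ∣ (weight S.O c₀ : ℤ) * v c₀
  · refine dvd_sub_prime_add_one_of_forall_dvd_weight_mul S hv hv0 (fun c => ?_) hℓ hℓN
    have := hcong c c₀
    have h := dvd_add this hw0
    simpa using h
  · exact dvd_sub_of_forall_dvd_weight_mul_sub (matrix S.O ℓ) (fun c => (weight S.O c : ℤ))
      (fun i j => S.weight_mul_matrix_symm ℓ i j) (fun j => S.sum_matrix_prime_eq hℓ hℓN j)
      ((mem_eigenLattice_iff.mp hv) ℓ hℓ hℓN) h3Z hw0 hcong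

/-! ### The criterion at every odd prime -/

/-- **Congruent weighted coordinates force Eisenstein eigenvalues, at every ODD prime `p`** (`5 ≤ p`: the Literature
criterion `XiSetup.dvd_sub_prime_add_one_of_forall_dvd`; `p = 3`: `dvd_sub_prime_add_one_of_forall_dvd_three`).
[cite: Ribet1990, §3 Thm. 3.12] [cite: PollackWeston2011, Prop. 6.3] -/
theorem dvd_sub_prime_add_one_of_forall_dvd_odd (S : XiSetup Nplus Nminus) [Fintype (ClassSet S.O)]
    {lam : ℕ → ℤ} {v : ClassSet S.O → ℤ} (hv : v ∈ eigenLattice (Nplus * Nminus) (matrix S.O) lam)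
    {p : ℕ} (hp : p.Prime) (hp2 : p ≠ 2) {c₀ : ClassSet S.O} (hv0 : ¬ (p : ℤ) ∣ v c₀)
    (hcong : ∀ c c', (p : ℤ) ∣ (weight S.O c : ℤ) * v c - (weight S.O c' : ℤ) * v c')
    {ℓ : ℕ} (hℓ : ℓ.Prime) (hℓN : ¬ ℓ ∣ Nplus * Nminus) :
    (p : ℤ) ∣ lam ℓ - (ℓ + 1) := by
  by_cases hp3 : p = 3
  · subst hp3
    exact dvd_sub_prime_add_one_of_forall_dvd_three S hv (by exact_mod_cast hv0)
      (fun c c' => by exact_mod_cast hcong c c') hℓ hℓN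
  · have h5 : 5 ≤ p := by
      have h2 := hp.two_le
      rcases Nat.lt_or_ge p 5 with hlt | hge
      · interval_cases p <;> simp_all (config := {decide := true})
      · exact hge
    exact S.dvd_sub_prime_add_one_of_forall_dvd hv hp h5 hv0 hcong hℓ hℓN

/-- **A non-Eisenstein eigenvalue produces non-congruent weighted coordinates, at every odd prime**: with `S`,
`v ∈ L(λ)`, `p` odd, `p ∤ v_{c₀}`, if one prime `ℓ ∤ N⁺N⁻` has `λ(ℓ) ≢ ℓ + 1 (mod p)` then
`p ∤ w_c v_c - w_{c'} v_{c'}` for some classes `c, c'`. (Literature twin: `XiSetup.exists_not_dvd_weight_mul_sub`,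
`5 ≤ p`.) [cite: Takahashi2001, Lemma 2.2] [cite: PollackWeston2011, Prop. 6.4 (1)] -/
theorem exists_not_dvd_weight_mul_sub_odd (S : XiSetup Nplus Nminus) [Fintype (ClassSet S.O)]
    {lam : ℕ → ℤ} {v : ClassSet S.O → ℤ} (hv : v ∈ eigenLattice (Nplus * Nminus) (matrix S.O) lam)
    {p : ℕ} (hp : p.Prime) (hp2 : p ≠ 2) {c₀ : ClassSet S.O} (hv0 : ¬ (p : ℤ) ∣ v c₀)
    {ℓ : ℕ} (hℓ : ℓ.Prime) (hℓN : ¬ ℓ ∣ Nplus * Nminus) (hne : ¬ (p : ℤ) ∣ lam ℓ - (ℓ + 1)) :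
    ∃ c c' : ClassSet S.O, ¬ (p : ℤ) ∣ (weight S.O c : ℤ) * v c - (weight S.O c' : ℤ) * v c' := by
  by_contra h
  push Not at h
  exact hne (dvd_sub_prime_add_one_of_forall_dvd_odd S hv hp hp2 hv0 h hℓ hℓN)

/-- **Degree-zero form at every odd prime**: under the hypotheses of `exists_not_dvd_weight_mul_sub_odd` there is a
degree-zero vector `y` (`Σ_c y_c = 0`, namely `e_c - e_{c'}`) with `p ∤ ⟨v, y⟩ = Σ_c w_c v_c y_c`. (Literature twin:
`XiSetup.exists_sum_eq_zero_not_dvd_pairing`, `5 ≤ p`.) [cite: Ribet1990, §3] [cite: Takahashi2001, Lemma 2.2] -/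
theorem exists_sum_eq_zero_not_dvd_pairing_odd (S : XiSetup Nplus Nminus) [Fintype (ClassSet S.O)]
    [DecidableEq (ClassSet S.O)] {lam : ℕ → ℤ} {v : ClassSet S.O → ℤ}
    (hv : v ∈ eigenLattice (Nplus * Nminus) (matrix S.O) lam)
    {p : ℕ} (hp : p.Prime) (hp2 : p ≠ 2) {c₀ : ClassSet S.O} (hv0 : ¬ (p : ℤ) ∣ v c₀)
    {ℓ : ℕ} (hℓ : ℓ.Prime) (hℓN : ¬ ℓ ∣ Nplus * Nminus) (hne : ¬ (p : ℤ) ∣ lam ℓ - (ℓ + 1)) :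
    ∃ y : ClassSet S.O → ℤ, ∑ c, y c = 0 ∧ ¬ (p : ℤ) ∣ ∑ c, (weight S.O c : ℤ) * v c * y c := by
  obtain ⟨c, c', hcc'⟩ := exists_not_dvd_weight_mul_sub_odd S hv hp hp2 hv0 hℓ hℓN hne
  have hne' : c ≠ c' := by
    rintro rfl
    exact hcc' (by rw [sub_self]; exact dvd_zero _)
  refine ⟨Pi.single c 1 - Pi.single c' 1, ?_, ?_⟩
  · simp only [Pi.sub_apply, Pi.single_apply, Finset.sum_sub_distrib, Finset.sum_ite_eq',
      Finset.mem_univ, if_true, sub_self]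
  · simp only [Pi.sub_apply, Pi.single_apply, mul_sub, mul_ite, mul_one, mul_zero,
      Finset.sum_sub_distrib, Finset.sum_ite_eq', Finset.mem_univ, if_true]
    exact hcc'

/-! ### Elliptic curves: `ρ̄_{E,p}` irreducible, `p` odd -/

/-- **`E[p]` irreducible ⇒ the `a(E)`-eigenvector is non-Eisenstein mod `p`, for every ODD `p`.** Let `E/ℚ` (model `W`)
have conductor `N_E = N⁺N⁻`, `S` a Brandt setup of type `(N⁺, N⁻)`, `p` an odd prime with `ρ̄_{E,p}` irreducible, and `v` a
vector of the `a(E)`-eigen-lattice with `p ∤ v_{c₀}`. Then `p ∤ w_c v_c - w_{c'} v_{c'}` for some classes `c, c'`: a good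
prime `ℓ ≠ p`, `ℓ ∤ N_E`, with `a_ℓ(E) ≢ ℓ + 1 (mod p)` exists (`exists_prime_not_dvd_lFunction_sub_of_hasIrreducibleModPGaloisRep`,
Chebotarev + Brauer–Nesbitt), then `exists_not_dvd_weight_mul_sub_odd`. (Literature twin: `PollackWestonNonEisenstein`'s
`exists_not_dvd_weight_mul_sub`, `5 ≤ p` and `ρ̄` surjective.) [cite: PollackWeston2011, Prop. 6.3–6.4] [cite: DarmonDiamondTaylor1995, Prop. 2.6(b)] -/
theorem exists_not_dvd_weight_mul_sub_of_irreducible (W : WeierstrassCurve ℚ) [W.IsElliptic]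
    (hN : W.conductorNorm ℤ = Nplus * Nminus) {p : ℕ} [Fact p.Prime] (hp2 : p ≠ 2)
    (hirr : W.HasIrreducibleModPGaloisRep p) (S : XiSetup Nplus Nminus) [Fintype (ClassSet S.O)]
    {v : ClassSet S.O → ℤ} (hv : v ∈ eigenLattice (Nplus * Nminus) (matrix S.O) fun n => W.LFunction n)
    {c₀ : ClassSet S.O} (hv0 : ¬ (p : ℤ) ∣ v c₀) :
    ∃ c c' : ClassSet S.O, ¬ (p : ℤ) ∣ (weight S.O c : ℤ) * v c - (weight S.O c' : ℤ) * v c' := by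
  obtain ⟨ℓ, hℓ, -, hℓN, hne⟩ := exists_prime_not_dvd_lFunction_sub_of_hasIrreducibleModPGaloisRep W p hirr
  rw [hN] at hℓN
  exact exists_not_dvd_weight_mul_sub_odd S hv Fact.out hp2 hv0 hℓ (by exact_mod_cast hℓN) hne

/-- **Degree-zero form** for `E[p]` irreducible, `p` odd: some `y ∈ ℤ[Cls O]⁰` has `p ∤ ⟨v, y⟩` — the functional
`u_J(v, ·)` on the character group `X_r(J₀(rM)) ≅ ℤ[Cls O]⁰` (Ribet 1990 Prop. 3.1) is non-zero modulo `p`.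
[cite: PollackWeston2011, Prop. 6.4 (1)] [cite: Ribet1990, §3] -/
theorem exists_sum_eq_zero_not_dvd_pairing_of_irreducible (W : WeierstrassCurve ℚ) [W.IsElliptic]
    (hN : W.conductorNorm ℤ = Nplus * Nminus) {p : ℕ} [Fact p.Prime] (hp2 : p ≠ 2)
    (hirr : W.HasIrreducibleModPGaloisRep p) (S : XiSetup Nplus Nminus) [Fintype (ClassSet S.O)]
    [DecidableEq (ClassSet S.O)] {v : ClassSet S.O → ℤ}
    (hv : v ∈ eigenLattice (Nplus * Nminus) (matrix S.O) fun n => W.LFunction n)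
    {c₀ : ClassSet S.O} (hv0 : ¬ (p : ℤ) ∣ v c₀) :
    ∃ y : ClassSet S.O → ℤ, ∑ c, y c = 0 ∧ ¬ (p : ℤ) ∣ ∑ c, (weight S.O c : ℤ) * v c * y c := by
  obtain ⟨ℓ, hℓ, -, hℓN, hne⟩ := exists_prime_not_dvd_lFunction_sub_of_hasIrreducibleModPGaloisRep W p hirr
  rw [hN] at hℓN
  exact exists_sum_eq_zero_not_dvd_pairing_odd S hv Fact.out hp2 hv0 hℓ (by exact_mod_cast hℓN) hne

/-- **`p ∤ i_r` for every odd `p` at which `E[p]` is irreducible** (Takahashi 2001 Thm. 2.7 / Pollack–Weston Prop. 6.4 (1)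
on the definite side, without `p ≥ 5` and without surjectivity). In a Brandt setup `S` of type `(N⁺, N⁻)`, `N⁺N⁻ = N_E`,
let `X ⊆ ℤ^{Cls O}` be the degree-zero sublattice, `g` a generator of the `a(E)`-eigen-line, and `i` an integer dividing
every pairing `⟨g, y⟩ = Σ_c w_c g_c y_c`, `y ∈ X` (e.g. Takahashi's `i_r`, the generator of that ideal). Then `p ∤ i`.
[cite: Takahashi2001, Lemma 2.2 and Thm. 2.7] [cite: PollackWeston2011, Prop. 6.4 (1)] -/
theorem not_dvd_generator_range_pairing_of_irreducible (W : WeierstrassCurve ℚ) [W.IsElliptic]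
    (hN : W.conductorNorm ℤ = Nplus * Nminus) {p : ℕ} [Fact p.Prime] (hp2 : p ≠ 2)
    (hirr : W.HasIrreducibleModPGaloisRep p) (S : XiSetup Nplus Nminus) [Fintype (ClassSet S.O)]
    (X : Submodule ℤ (ClassSet S.O → ℤ)) (hX : ∀ y, y ∈ X ↔ ∑ c, y c = 0) {g : ClassSet S.O → ℤ} (hg : g ≠ 0)
    (hL : eigenLattice (Nplus * Nminus) (matrix S.O) (fun n => W.LFunction n) = ℤ ∙ g) {i : ℤ}
    (hi : ∀ y ∈ X, i ∣ ∑ c, (weight S.O c : ℤ) * g c * y c) : ¬ (p : ℤ) ∣ i := by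
  classical
  obtain ⟨c₀, hc₀⟩ := exists_not_dvd_of_eigenLattice_eq_span hg hL (Fact.out : p.Prime)
  obtain ⟨y, hy0, hy⟩ := exists_sum_eq_zero_not_dvd_pairing_of_irreducible W hN hp2 hirr S
    (hL ▸ Submodule.mem_span_singleton_self g) hc₀
  exact fun hp => hy (dvd_trans hp (hi y ((hX y).mpr hy0)))

/-- **Pollack–Weston Lemma 2.1 for every odd `p` with `E[p]` irreducible** (corollary): for the generator `φ` of the
`a(E)`-eigen-line some `w_c φ_c` is prime to `p` — from `c, c'` with `p ∤ w_c φ_c - w_{c'} φ_{c'}` one of the two terms is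
a unit. The landed `pollackWeston2011_lemma21_holds` (gen 41) asks `ρ̄_{E,p}` surjective; only irreducibility is needed.
[cite: PollackWeston2011, §2.1 Lemma 2.1] -/
theorem exists_not_dvd_weight_mul_of_irreducible (W : WeierstrassCurve ℚ) [W.IsElliptic]
    (hN : W.conductorNorm ℤ = Nplus * Nminus) {p : ℕ} [Fact p.Prime] (hp2 : p ≠ 2)
    (hirr : W.HasIrreducibleModPGaloisRep p) (S : XiSetup Nplus Nminus) [Fintype (ClassSet S.O)]
    {φ : ClassSet S.O → ℤ} (hφ0 : φ ≠ 0)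
    (hφ : eigenLattice (Nplus * Nminus) (matrix S.O) (fun n => W.LFunction n) = ℤ ∙ φ) :
    ∃ c : ClassSet S.O, ¬ (p : ℤ) ∣ (weight S.O c : ℤ) * φ c := by
  obtain ⟨c₀, hc₀⟩ := exists_not_dvd_of_eigenLattice_eq_span hφ0 hφ (Fact.out : p.Prime)
  obtain ⟨c, c', hcc'⟩ := exists_not_dvd_weight_mul_sub_of_irreducible W hN hp2 hirr S
    (hφ ▸ Submodule.mem_span_singleton_self φ) hc₀
  by_contra h
  push Not at h
  exact hcc' (dvd_sub (h c) (h c'))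

end Summit.BirchSwinnertonDyer.BirchSwinnertonDyer.Theorems.PollackWestonLemma21

end
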